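import Summits.CriticalPhenomena.PercolationContinuityZ3.Theorems.Transplant.FKDoubleFanWedge
import HarnessLib

/-!
# Double fans `K₂ ∨ P_{m+1}`: the ORBIT CONE — an explicit polyhedral cone of bivectors, stable under the three polarisations
# `T_D, T_a, T_b` (and the axis scalings) for every `q ∈ [0,1]`, containing every `u`-side pair bivector `u ∧ P_a u`, `u ∈ InKE`

Helper file (`--supports stmt-CriticalPhenomena-4575`), FK sub-lane `prim-bschramm-fk-3` (gen 28); builds on p205010 (kernel theorem, internal
audit signed; external expert review pending).  No named facts, no sorries; standard axioms.  Memo `bschramm/prim-bschramm-fk-3/FAR-CROSS-III.md` §6.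

In the basis `(e_z, a₃, e_y) ⊗ (b₂, e_v)` of `∧²ℝ⁵` the polarisations are non-negative matrices; the pair bivector `β_u = u ∧ P_a u` has eight
non-negative tensor coordinates and two signed ones.  **`orbitCone q`** is cut out by SEVENTEEN linear facets: the eight non-negative tensor
coordinates, `xv ≥ 0`... (`c_za, c_zy, c_ay | c_ab, c_av, c_zb, c_zv | c_bv`), the three seed functionals `β_yv, β_zv, ℓ_D(β)`, and six pull-backs
(`c_ab∘T_D`, `c_av∘T_D`, `yv∘T_D`, `c_ab∘T_D∘T_a`, `c_av∘T_D∘T_a`, `c_av∘T_D∘T_b`).  Main results: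
* **`orbitCone_opTD_mem`, `orbitCone_opTa_mem`, `orbitCone_opTb_mem`, `orbitCone_opAB_mem`** (+ `zero/add/smul`): the cone is stable — the
  pull-back hierarchy of these facets CLOSES (51 explicit Farkas identities with multipliers in `{1,2,3,4,q,1+q,2+q}`), for every `0 ≤ q ≤ 1`;
* **`wedgeH_mem_orbitCone`**: `u ∧ P_a u ∈ orbitCone q` for every `u ∈ InKE q` (only masses `≥ 0`, `κ_bc(u) ≥ 0` and `N^{(bc)}(u) ≥ 0` enter);
* hence (**`orbitCone_signs`**) the three sign conditions `β_yv, β_zv, ℓ_D(β) ≥ 0` of `IsTCone` (`…DoubleFanSeedCone`) hold on the whole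
  `{T_D,T_a,T_b}`-orbit cone of the inputs: for the termwise route to all-distance negative correlation it remains ONLY to find a
  `{T_D,T_a,T_b}`-stable cone between the inputs and the positivity half-spaces (intersect it with `orbitCone q`, add `seedCone q`).
[cite: Grimmett2006, §3.9 eq. (3.94) (pp. 63–64)] [folklore]
-/

noncomputable section

namespace Summit.CriticalPhenomena.PercolationContinuityZ3.Theorems

namespace FK

namespace ThreeApex

/-- **The orbit cone** (17 facets; `p = 1 − q`):
`c_za = −uz`, `c_zy = −uy+uz−yz`, `c_ay = uy`, `c_ab = ux`, `c_av = uv−ux`, `c_zb = −xz−ux`, `c_zv = zv+xz−uv+ux`, `yv`, `zv`, `ℓ_D`,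
`φ₁ = −(1+2p)ux+uv−xy−xz`, `φ₂ = (1+p)(ux−uv)+xy+xz+yv+zv`, `φ₃ = −(1+p)uv+p·xy+2yv+zv`, `φ₄ = uv−xy`, `φ₅ = −(1+p)uv+xy+2yv+zv`,
`φ₆ = −(1+p)uv+xz+yv+2zv`, `xv`, all `≥ 0`. [folklore] -/
def orbitCone (q : ℝ) : Set Biv :=
  {β | 0 ≤ -β.uz ∧ 0 ≤ -β.uy + β.uz - β.yz ∧ 0 ≤ β.uy ∧ 0 ≤ β.ux ∧ 0 ≤ β.uv - β.ux ∧ 0 ≤ -β.xz - β.ux ∧ 0 ≤ β.zv + β.xz - β.uv + β.ux ∧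
    0 ≤ β.yv ∧ 0 ≤ β.zv ∧ 0 ≤ (1 - q) * (2 - q) * β.ux - (2 - q) * β.uv + (1 - q) * β.xy + (1 - q) * β.xz + β.yv + β.zv ∧
    0 ≤ -(3 - 2 * q) * β.ux + β.uv - β.xy - β.xz ∧ 0 ≤ (2 - q) * β.ux - (2 - q) * β.uv + β.xy + β.xz + β.yv + β.zv ∧
    0 ≤ -(2 - q) * β.uv + (1 - q) * β.xy + 2 * β.yv + β.zv ∧ 0 ≤ β.uv - β.xy ∧ 0 ≤ -(2 - q) * β.uv + β.xy + 2 * β.yv + β.zv ∧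
    0 ≤ -(2 - q) * β.uv + β.xz + β.yv + 2 * β.zv ∧ 0 ≤ β.xv}

/-- The three seed functionals are facets of the orbit cone: `β_yv, β_zv, ℓ_D(β) ≥ 0`. [folklore] -/
theorem orbitCone_signs {q : ℝ} {β : Biv} (hβ : β ∈ orbitCone q) : 0 ≤ β.yv ∧ 0 ≤ β.zv ∧ 0 ≤ formD q β := by
  simp only [orbitCone, Set.mem_setOf_eq] at hβ
  obtain ⟨-, -, -, -, -, -, -, h8, h9, h10, -⟩ := hβ
  exact ⟨h8, h9, by simp only [formD]; linarith⟩

/-- `0 ∈ orbitCone q`. [folklore] -/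
theorem zero_mem_orbitCone (q : ℝ) : (⟨0, 0, 0, 0, 0, 0, 0, 0, 0, 0⟩ : Biv) ∈ orbitCone q := by
  simp only [orbitCone, Set.mem_setOf_eq]; refine ⟨?_, ?_, ?_, ?_, ?_, ?_, ?_, ?_, ?_, ?_, ?_, ?_, ?_, ?_, ?_, ?_, ?_⟩ <;> nlinarith

set_option maxHeartbeats 400000 in
/-- `orbitCone q` is closed under sums. [folklore] -/
theorem orbitCone_add_mem {q : ℝ} {β γ : Biv} (hβ : β ∈ orbitCone q) (hγ : γ ∈ orbitCone q) : Biv.add β γ ∈ orbitCone q := by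
  simp only [orbitCone, Set.mem_setOf_eq] at hβ hγ ⊢
  obtain ⟨b1, b2, b3, b4, b5, b6, b7, b8, b9, b10, b11, b12, b13, b14, b15, b16, b17⟩ := hβ
  obtain ⟨c1, c2, c3, c4, c5, c6, c7, c8, c9, c10, c11, c12, c13, c14, c15, c16, c17⟩ := hγ
  simp only [Biv.add]
  exact ⟨by linarith, by linarith, by linarith, by linarith, by linarith, by linarith, by linarith, by linarith, by linarith, by nlinarith,
    by nlinarith, by nlinarith, by nlinarith, by linarith, by nlinarith, by nlinarith, by linarith⟩

/-- `orbitCone q` is closed under non-negative multiples. [folklore] -/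
theorem orbitCone_smul_mem {q t : ℝ} (ht : 0 ≤ t) {β : Biv} (hβ : β ∈ orbitCone q) : Biv.smul t β ∈ orbitCone q := by
  simp only [orbitCone, Set.mem_setOf_eq] at hβ ⊢
  obtain ⟨b1, b2, b3, b4, b5, b6, b7, b8, b9, b10, b11, b12, b13, b14, b15, b16, b17⟩ := hβ
  simp only [Biv.smul]
  exact ⟨by nlinarith [mul_nonneg ht b1], by nlinarith [mul_nonneg ht b2], mul_nonneg ht b3, mul_nonneg ht b4, by nlinarith [mul_nonneg ht b5],
    by nlinarith [mul_nonneg ht b6], by nlinarith [mul_nonneg ht b7], mul_nonneg ht b8, mul_nonneg ht b9, by nlinarith [mul_nonneg ht b10],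
    by nlinarith [mul_nonneg ht b11], by nlinarith [mul_nonneg ht b12], by nlinarith [mul_nonneg ht b13], by nlinarith [mul_nonneg ht b14],
    by nlinarith [mul_nonneg ht b15], by nlinarith [mul_nonneg ht b16], mul_nonneg ht b17⟩

/-- **`T_D` maps the orbit cone into itself** (`0 ≤ q`).  Farkas identities: `c_za∘T_D = q·c_za + c_zy`, `c_zy∘T_D = 0`, `c_ay∘T_D = q·c_ay + c_zy`,
`c_ab∘T_D = φ₁`, `c_av∘T_D = φ₂`, `c_zb∘T_D = q·c_zb + c_zv`, `c_zv∘T_D = 0`, `yv∘T_D = φ₃`, `zv∘T_D = φ₆ + q(c_zb + c_ab)`, `ℓ_D∘T_D = 2q·ℓ_D`,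
`φ₁∘T_D = 2ℓ_D + qφ₁`, `φ₂∘T_D = qφ₂`, `φ₃∘T_D = 2ℓ_D + qφ₃`, `φ₄∘T_D = φ₁ + φ₃`, `φ₅∘T_D = φ₆∘T_D = 2ℓ_D + qφ₂`, `xv∘T_D = q·xv`. [folklore] -/
theorem orbitCone_opTD_mem {q : ℝ} (hq0 : 0 ≤ q) {β : Biv} (hβ : β ∈ orbitCone q) : opTD q β ∈ orbitCone q := by
  simp only [orbitCone, Set.mem_setOf_eq] at hβ ⊢
  obtain ⟨b1, b2, b3, b4, b5, b6, b7, b8, b9, b10, b11, b12, b13, b14, b15, b16, b17⟩ := hβ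
  simp only [opTD]
  refine ⟨?_, ?_, ?_, ?_, ?_, ?_, ?_, ?_, ?_, ?_, ?_, ?_, ?_, ?_, ?_, ?_, ?_⟩
  · nlinarith [mul_nonneg hq0 b1, b2]
  · nlinarith [b2]
  · nlinarith [mul_nonneg hq0 b3, b2]
  · nlinarith [b11]
  · nlinarith [b12]
  · nlinarith [mul_nonneg hq0 b6, b7]
  · nlinarith [b7]
  · nlinarith [b13]
  · nlinarith [b16, mul_nonneg hq0 b6, mul_nonneg hq0 b4]
  · nlinarith [mul_nonneg hq0 b10]
  · nlinarith [b10, mul_nonneg hq0 b11]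
  · nlinarith [mul_nonneg hq0 b12]
  · nlinarith [b10, mul_nonneg hq0 b13]
  · nlinarith [b11, b13]
  · nlinarith [b10, mul_nonneg hq0 b12]
  · nlinarith [b10, mul_nonneg hq0 b12]
  · nlinarith [mul_nonneg hq0 b17]

/-- **`T_a` maps the orbit cone into itself.**  (`c_zy∘T_a = c_za + c_zy`, `c_av∘T_a = c_ab + c_av`, `c_zv∘T_a = c_zv + c_zb`,
`zv∘T_a = c_ab + c_av + c_zv + c_zb`, `ℓ_D∘T_a = φ₃`, `φ₁∘T_a = φ₄`, `φ₂∘T_a = φ₅`, `φ₃∘T_a = φ₃ + 2yv`, `φ₅∘T_a = φ₅ + 2yv`,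
`φ₆∘T_a = φ₆ + yv + c_zb + c_ab`, the rest diagonal or zero.) [folklore] -/
theorem orbitCone_opTa_mem {q : ℝ} {β : Biv} (hβ : β ∈ orbitCone q) : opTa β ∈ orbitCone q := by
  simp only [orbitCone, Set.mem_setOf_eq] at hβ ⊢
  obtain ⟨b1, b2, b3, b4, b5, b6, b7, b8, b9, b10, b11, b12, b13, b14, b15, b16, b17⟩ := hβ
  simp only [opTa]
  refine ⟨?_, ?_, ?_, ?_, ?_, ?_, ?_, ?_, ?_, ?_, ?_, ?_, ?_, ?_, ?_, ?_, ?_⟩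
  · nlinarith [b1]
  · nlinarith [b1, b2]
  · nlinarith [b3]
  · nlinarith [b4]
  · nlinarith [b4, b5]
  · nlinarith [b6]
  · nlinarith [b7, b6]
  · nlinarith [b8]
  · nlinarith [b4, b5, b7, b6]
  · nlinarith [b13]
  · nlinarith [b14]
  · nlinarith [b15]
  · nlinarith [b13, b8]
  · nlinarith [b14]
  · nlinarith [b15, b8]
  · nlinarith [b16, b8, b6, b4]
  · nlinarith [b17]

/-- **`T_b` maps the orbit cone into itself.**  (`c_zy∘T_b = c_ay + c_zy`, `c_av∘T_b = c_ab + c_av`, `c_zb∘T_b = c_ab + c_zb`,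
`c_zv∘T_b = c_av + 2c_zv + c_zb`, `zv∘T_b = 2(c_ab + c_av + c_zv + c_zb)`, `ℓ_D∘T_b = φ₆ + q(c_zb + c_ab)`, `φ₁∘T_b = 2c_ab + c_av + c_zb`,
`φ₂∘T_b = φ₆`, `φ₃∘T_b = φ₅∘T_b = q(c_ab + c_av) + 2c_zv + 2yv + 2c_zb`, `φ₄∘T_b = c_ab + c_av`,
`φ₆∘T_b = (1+q)c_ab + (2+q)c_av + 4c_zv + yv + 3c_zb`, the rest diagonal or zero.) [folklore] -/
theorem orbitCone_opTb_mem {q : ℝ} (hq0 : 0 ≤ q) {β : Biv} (hβ : β ∈ orbitCone q) : opTb β ∈ orbitCone q := by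
  simp only [orbitCone, Set.mem_setOf_eq] at hβ ⊢
  obtain ⟨b1, b2, b3, b4, b5, b6, b7, b8, b9, b10, b11, b12, b13, b14, b15, b16, b17⟩ := hβ
  simp only [opTb]
  refine ⟨?_, ?_, ?_, ?_, ?_, ?_, ?_, ?_, ?_, ?_, ?_, ?_, ?_, ?_, ?_, ?_, ?_⟩
  · nlinarith [b1]
  · nlinarith [b3, b2]
  · nlinarith [b3]
  · nlinarith [b4]
  · nlinarith [b4, b5]
  · nlinarith [b4, b6]
  · nlinarith [b5, b7, b6]
  · nlinarith [b8]
  · nlinarith [b4, b5, b7, b6]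
  · nlinarith [b16, mul_nonneg hq0 b6, mul_nonneg hq0 b4]
  · nlinarith [b4, b5, b6]
  · nlinarith [b16]
  · nlinarith [mul_nonneg hq0 b4, mul_nonneg hq0 b5, b7, b8, b6]
  · nlinarith [b4, b5]
  · nlinarith [mul_nonneg hq0 b4, mul_nonneg hq0 b5, b7, b8, b6]
  · nlinarith [mul_nonneg hq0 b4, mul_nonneg hq0 b5, b4, b5, b7, b8, b6]
  · nlinarith [b17]

/-- **The axis scalings map the orbit cone into itself** (every facet lives in one block and the axis scaling acts on the blocks by the
non-negative scalars `(1−w)², (1−w), 1`). [folklore] -/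
theorem orbitCone_opAB_mem {q w : ℝ} (hw1 : w ≤ 1) {β : Biv} (hβ : β ∈ orbitCone q) : opAB w β ∈ orbitCone q := by
  simp only [orbitCone, Set.mem_setOf_eq] at hβ ⊢
  obtain ⟨b1, b2, b3, b4, b5, b6, b7, b8, b9, b10, b11, b12, b13, b14, b15, b16, b17⟩ := hβ
  have hw : 0 ≤ 1 - w := by linarith
  have hw2 : 0 ≤ (1 - w) ^ 2 := sq_nonneg _
  simp only [opAB]
  refine ⟨?_, ?_, ?_, ?_, ?_, ?_, ?_, ?_, ?_, ?_, ?_, ?_, ?_, ?_, ?_, ?_, ?_⟩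
  · nlinarith [mul_nonneg hw2 b1]
  · nlinarith [mul_nonneg hw2 b2]
  · nlinarith [mul_nonneg hw2 b3]
  · nlinarith [mul_nonneg hw b4]
  · nlinarith [mul_nonneg hw b5]
  · nlinarith [mul_nonneg hw b6]
  · nlinarith [mul_nonneg hw b7]
  · nlinarith [mul_nonneg hw b8]
  · nlinarith [mul_nonneg hw b9]
  · nlinarith [mul_nonneg hw b10]
  · nlinarith [mul_nonneg hw b11]
  · nlinarith [mul_nonneg hw b12]
  · nlinarith [mul_nonneg hw b13]
  · nlinarith [mul_nonneg hw b14]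
  · nlinarith [mul_nonneg hw b15]
  · nlinarith [mul_nonneg hw b16]
  · exact b17

/-! ### The inputs lie in the orbit cone -/

/-- The `u`-side pair bivector `u ∧ P_a u` (`edgeAC 0 ∗ u = u`, `P_a = edgeAC 1 ∗ ·`) in hat–Plücker coordinates. [folklore] -/
theorem wedgeH_crossA_input (u : V5) :
    wedgeH (conv (edgeAC 0) u) (conv (edgeAC 1) u) =
      ⟨0, u.z0 * (u.z0 + u.zac), 0, u.z0 * (u.z0 + u.zab + u.zac + u.zbc + u.z1), (u.z0 + u.zab) * (u.z0 + u.zac), 0,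
        (u.z0 + u.zab) * (u.z0 + u.zab + u.zac + u.zbc + u.z1), -((u.z0 + u.zac) * (u.z0 + u.zbc)), 0,
        (u.z0 + u.zbc) * (u.z0 + u.zab + u.zac + u.zbc + u.z1)⟩ := by
  ext <;> simp only [wedgeH, conv, edgeAC, hx, hy, hz, V5.total] <;> ring

/-- **Every input lies in the orbit cone**: `u ∧ P_a u ∈ orbitCone q` for `u ∈ InKE q`, `0 ≤ q ≤ 1`.  The facets evaluate to products of masses,
to `κ_bc(u) = kap (swapAB u)` (`φ₁, φ₄`), to `N^{(bc)}(u) = masterN q (swapAB u)` (`ℓ_D, φ₃`) and to `N^{(bc)}(u) + q·x̂ŷ` (`φ₂, φ₅`). [folklore] -/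
theorem wedgeH_mem_orbitCone {q : ℝ} (hq0 : 0 ≤ q) (hq1 : q ≤ 1) {u : V5} (hu : InKE q u) :
    wedgeH (conv (edgeAC 0) u) (conv (edgeAC 1) u) ∈ orbitCone q := by
  have hv := hu.valid hq0 hq1
  obtain ⟨g0, g1, g2, g3, g4⟩ := hv.nonneg
  have hN : 0 ≤ masterN q (ThreeApex.swapAB u) := hv.nBC
  have hK : 0 ≤ kap (ThreeApex.swapAB u) := hv.kapC
  simp only [masterN, ThreeApex.swapAB] at hN
  simp only [kap, ThreeApex.swapAB] at hK
  rw [wedgeH_crossA_input]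
  simp only [orbitCone, Set.mem_setOf_eq]
  have hT : 0 ≤ u.z0 + u.zab + u.zac + u.zbc + u.z1 := by linarith
  refine ⟨?_, ?_, ?_, ?_, ?_, ?_, ?_, ?_, ?_, ?_, ?_, ?_, ?_, ?_, ?_, ?_, ?_⟩
  · simp
  · nlinarith [mul_nonneg (add_nonneg g0 g2) g3]
  · nlinarith [mul_nonneg g0 (add_nonneg g0 g2)]
  · simp
  · nlinarith [mul_nonneg g0 hT]
  · simp
  · nlinarith [mul_nonneg g3 hT]
  · simp
  · exact mul_nonneg (by linarith) hT
  · nlinarith [hN]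
  · nlinarith [hK]
  · nlinarith [hN, mul_nonneg hq0 (mul_nonneg (add_nonneg g0 g1) (add_nonneg g0 g2))]
  · nlinarith [hN]
  · nlinarith [hK]
  · nlinarith [hN, mul_nonneg hq0 (mul_nonneg (add_nonneg g0 g1) (add_nonneg g0 g2))]
  · nlinarith [mul_nonneg g3 hT, mul_nonneg hq0 (mul_nonneg g0 hT)]
  · exact mul_nonneg (by linarith) hT

/-! ### `T`-stable cones and the intersection with the orbit cone -/

/-- A convex cone of bivectors stable under the three polarisations and the axis scalings (no sign conditions, no rank-one operators). [folklore] -/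
@[folklore] structure IsTStable (q : ℝ) (K : Set Biv) : Prop where
  /-- `0 ∈ K` -/
  zero_mem : (⟨0, 0, 0, 0, 0, 0, 0, 0, 0, 0⟩ : Biv) ∈ K
  /-- closed under sums -/
  add_mem : ∀ β γ, β ∈ K → γ ∈ K → Biv.add β γ ∈ K
  /-- closed under non-negative multiples -/
  smul_mem : ∀ (a : ℝ) β, 0 ≤ a → β ∈ K → Biv.smul a β ∈ K
  /-- `T_D K ⊆ K` -/
  td : ∀ β, β ∈ K → opTD q β ∈ K
  /-- `T_a K ⊆ K` -/
  ta : ∀ β, β ∈ K → opTa β ∈ K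
  /-- `T_b K ⊆ K` -/
  tb : ∀ β, β ∈ K → opTb β ∈ K
  /-- the axis scalings -/
  ab : ∀ (w : ℝ) β, 0 ≤ w → w ≤ 1 → β ∈ K → opAB w β ∈ K

/-- **The orbit cone is `T`-stable** (`0 ≤ q`). [folklore] -/
theorem isTStable_orbitCone {q : ℝ} (hq0 : 0 ≤ q) : IsTStable q (orbitCone q) where
  zero_mem := zero_mem_orbitCone q
  add_mem := fun _ _ hβ hγ => orbitCone_add_mem hβ hγ
  smul_mem := fun _ _ ht hβ => orbitCone_smul_mem ht hβ
  td := fun _ hβ => orbitCone_opTD_mem hq0 hβ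
  ta := fun _ hβ => orbitCone_opTa_mem hβ
  tb := fun _ hβ => orbitCone_opTb_mem hq0 hβ
  ab := fun _ _ _ hw1 hβ => orbitCone_opAB_mem hw1 hβ

/-- **Intersecting with the orbit cone.**  If `K` is `T`-stable then so is `K ∩ orbitCone q`, and on the intersection the three seed functionals are
non-negative — so `K ∩ orbitCone q` satisfies every hypothesis of `IsTCone` (`…DoubleFanSeedCone`) that does not mention the pairing; and it still
contains every input `u ∧ P_a u`, `u ∈ InKE q`, that `K` contains. [folklore] -/
theorem IsTStable.inter_orbitCone {q : ℝ} {K : Set Biv} (hK : IsTStable q K) (hq0 : 0 ≤ q) :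
    IsTStable q (K ∩ orbitCone q) ∧ (∀ β, β ∈ K ∩ orbitCone q → 0 ≤ β.yv ∧ 0 ≤ β.zv ∧ 0 ≤ formD q β) := by
  refine ⟨⟨⟨hK.zero_mem, zero_mem_orbitCone q⟩, fun β γ hβ hγ => ⟨hK.add_mem _ _ hβ.1 hγ.1, orbitCone_add_mem hβ.2 hγ.2⟩,
    fun t β ht hβ => ⟨hK.smul_mem _ _ ht hβ.1, orbitCone_smul_mem ht hβ.2⟩, fun β hβ => ⟨hK.td _ hβ.1, orbitCone_opTD_mem hq0 hβ.2⟩,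
    fun β hβ => ⟨hK.ta _ hβ.1, orbitCone_opTa_mem hβ.2⟩, fun β hβ => ⟨hK.tb _ hβ.1, orbitCone_opTb_mem hq0 hβ.2⟩,
    fun w β hw0 hw1 hβ => ⟨hK.ab w _ hw0 hw1 hβ.1, orbitCone_opAB_mem hw1 hβ.2⟩⟩, fun β hβ => orbitCone_signs hβ.2⟩

end ThreeApex

end FK

end Summit.CriticalPhenomena.PercolationContinuityZ3.Theorems
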